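import Summits.BirchSwinnertonDyer.Rank1Residual.GaloisImage.LocalUnitsValuationSequence
import Summits.BirchSwinnertonDyer.Rank1Residual.GaloisImage.LocalUnitsModPTransfer
import HarnessLib

/-!
# `#Hom_Δ(Z, Eˣ/p) = #Hom_Δ(Z, 𝒪_Eˣ/p) · #Z^Δ`: the valuation sequence counted
# (cell `b2b-bsdres`, team n1011, row T-EPC = Tate's local Euler–Poincaré characteristic; seat p04 GEN 7; stage B5b)

HONEST FRAMING (cell `b2b-bsdres`, run/shared/lean/b2b/bsd-rank1-residual/, verbatim in every
file): the goal of the cell is to DELETE the COMBINATION-SHAPED residual classes of the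
Birch–Swinnerton-Dyer formula for ALL analytic-rank `≤ 1` elliptic curves over `ℚ` — "full BSD
formula for every rank `≤ 1` curve in class `C`" assembled STRICTLY from published theorems — so
that the rank-`≤ 1` remainder becomes exactly the CONSTRUCTION-SHAPED classes, which are TYPED
(missing-input `Prop`s), NOT attempted. This is not "finishing BSD". Team n1011 (N10 / N11, the
additive block X4 ∧ `p = 3`): research route; no claim beyond the stated classes; nothing is
booked; no mark / label is changed by this file. Theorems only (no definition, no named fact, no
`sorry`); TOOL theorems on local fields.  (Placement: Summits/GaloisImage pending the operator
move of the T-EPC cone to the Literature homes.)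

## What

`E/K` finite Galois with `Gal(E/K)` preserving the valuation, `E` a non-archimedean local field of
characteristic `0`, `|p| < 1`, `Δ = Gal(E/K)`, `p ∤ #Δ`, `Z` finite with `pZ = 0`:

* `OneUnits.natCard_modP_field_units` — the exact sequence of `Δ`-modules
  `0 → 𝒪_Eˣ/p → Eˣ/p → ℤ/p → 0` (valuation; `ℤ/p` with trivial action) gives, by stage A1
  (`natCard_intertwiningMap_eq_mul`, `natCard_intertwiningMap_zmod`),
  **`#Hom_Δ(Z, Eˣ/p) = #Hom_Δ(Z, 𝒪_Eˣ/p) · #Z^Δ`**.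

With stages B4c and B5a this is the `Eˣ`-form of Milne's Lemma 2.11 up to the integer term
(`[Eˣ/p] = [𝒪_E/p] + [μ_p(E)] + [𝔽_p]`); the normal-basis count of `[𝒪_E/p]` is stage B6.

References: J. S. Milne, *Arithmetic Duality Theorems* (2006), I §2, Lemma 2.11 [MilneADT2006];
J.-P. Serre, *Local Fields*, XIV §4 [SerreLocalFields1979].
-/

noncomputable section

open Function
open scoped ValuativeRel

namespace Summit.BirchSwinnertonDyer.Rank1Residual.GaloisImage

namespace OneUnits

open Representation

variable {K : Type*} [Field K] {E : Type*} [Field E] [Algebra K E] [ValuativeRel E]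
  [TopologicalSpace E] [IsNonarchimedeanLocalField E]
variable (p : ℕ) [hp : Fact p.Prime]

section Count

variable [FiniteDimensional K E]

/-- **`#Hom_Δ(Z, Eˣ/p) = #Hom_Δ(Z, 𝒪_Eˣ/p) · #Z^Δ`** from the valuation sequence
`0 → 𝒪_Eˣ/p → Eˣ/p → ℤ/p → 0` of `Gal(E/K)`-modules (`p ∤ #Gal(E/K)`, `pZ = 0`).
[cite: MilneADT2006, I §2 Lemma 2.11 (p. 33)] [cite: SerreLocalFields1979, XIV §4] -/
theorem natCard_modP_field_units [CharZero E] (hpv : ValuativeRel.valuation E p < 1)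
    (hσ : ∀ (σ : E ≃ₐ[K] E) (x : E), ValuativeRel.valuation E (σ x) = ValuativeRel.valuation E x)
    (hG : ¬ p ∣ Nat.card (E ≃ₐ[K] E))
    {Z : Type*} [AddCommGroup Z] [Finite Z] (σZ : Representation ℤ (E ≃ₐ[K] E) Z)
    (hZ : ∀ z : Z, p • z = 0)
    (U₁ U₂ OU : Submodule ℤ (Additive Eˣ))
    (hU₁ : ∀ u : Additive Eˣ, u ∈ U₁ ↔ ∃ b ∈ 𝒪[E], ((Additive.toMul u : Eˣ) : E) = 1 + (p : E) ^ 1 * b)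
    (hU₂ : ∀ u : Additive Eˣ, u ∈ U₂ ↔ ∃ b ∈ 𝒪[E], ((Additive.toMul u : Eˣ) : E) = 1 + (p : E) ^ 2 * b)
    (hOU : ∀ u : Additive Eˣ, u ∈ OU ↔
      ((Additive.toMul u : Eˣ) : E) ∈ 𝒪[E] ∧ (((Additive.toMul u)⁻¹ : Eˣ) : E) ∈ 𝒪[E])
    (hU₁st : ∀ σ, U₁ ≤ U₁.comap (Representation.ofMulDistribMulAction (E ≃ₐ[K] E) Eˣ σ))
    (hOUst : ∀ σ, OU ≤ OU.comap (Representation.ofMulDistribMulAction (E ≃ₐ[K] E) Eˣ σ))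
    (O : Submodule ℤ E) (hO : ∀ x, x ∈ O ↔ x ∈ 𝒪[E])
    (hOst : ∀ σ, O ≤ O.comap (Representation.ofDistribMulAction ℤ (E ≃ₐ[K] E) E σ)) :
    Nat.card (IntertwiningMap σZ ((Representation.ofMulDistribMulAction (E ≃ₐ[K] E) Eˣ).quotient _
        (ModPRepCount.range_lsmul_le_comap (Representation.ofMulDistribMulAction (E ≃ₐ[K] E) Eˣ) p))) =
    Nat.card (IntertwiningMap σZ (((Representation.ofMulDistribMulAction (E ≃ₐ[K] E) Eˣ).subrepresentation
        OU hOUst).quotient _ (ModPRepCount.range_lsmul_le_comap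
          ((Representation.ofMulDistribMulAction (E ≃ₐ[K] E) Eˣ).subrepresentation OU hOUst) p))) *
    Nat.card σZ.invariants := by
  classical
  haveI : Finite (E ≃ₐ[K] E) := inferInstance
  have hp0 : p ≠ 0 := hp.out.ne_zero
  -- the integer valuation as an additive map
  let ord : Additive Eˣ →+ ℤ :=
    { toFun := fun u => WithZero.log (IsNonarchimedeanLocalField.valueGroupWithZeroIsoInt E
        (ValuativeRel.valuation E ((Additive.toMul u : Eˣ) : E)))
      map_zero' := by simp
      map_add' := fun u w => by
        simp only [toMul_add, Units.val_mul]
        exact log_valuation_mul (Units.ne_zero _) (Units.ne_zero _) }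
  have hord : ∀ u : Additive Eˣ, ord u = WithZero.log (IsNonarchimedeanLocalField.valueGroupWithZeroIsoInt E
      (ValuativeRel.valuation E ((Additive.toMul u : Eˣ) : E))) := fun u => rfl
  have hordσ : ∀ (σ : E ≃ₐ[K] E) (u : Additive Eˣ),
      ord (Representation.ofMulDistribMulAction (E ≃ₐ[K] E) Eˣ σ u) = ord u := fun σ u => by
    rw [hord, hord, coe_ofMulDistribMulAction_apply, hσ]
  have hordO : ∀ u : Additive Eˣ, ord u = 0 ↔ u ∈ OU := fun u => by
    rw [hord, log_valuation_eq_zero_iff (Units.ne_zero _), hOU, mem_units_iff_valuation_eq_one]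
  obtain ⟨ϖ, hϖ⟩ := exists_log_valuation_eq_neg_one (E := E)
  have hordϖ : ord (Additive.ofMul ϖ) = -1 := by rw [hord, toMul_ofMul]; exact hϖ
  -- the three representations
  set ρU := Representation.ofMulDistribMulAction (E ≃ₐ[K] E) Eˣ with hρU
  -- `g : Eˣ/p → ℤ/p`
  let g₀ : Additive Eˣ →ₗ[ℤ] ZMod p := ((Int.castAddHom (ZMod p)).comp ord).toIntLinearMap
  have hg₀ : ∀ u, g₀ u = ((ord u : ℤ) : ZMod p) := fun u => rfl
  have hg₀p : LinearMap.range (LinearMap.lsmul ℤ (Additive Eˣ) p) ≤ LinearMap.ker g₀ := by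
    rintro _ ⟨w, rfl⟩
    rw [LinearMap.mem_ker, hg₀, LinearMap.lsmul_apply, map_zsmul, ZMod.intCast_zmod_eq_zero_iff_dvd]
    exact ⟨ord w, by rw [smul_eq_mul]⟩
  let gL := (LinearMap.range (LinearMap.lsmul ℤ (Additive Eˣ) p)).liftQ g₀ hg₀p
  have hgL : ∀ u, gL (Submodule.Quotient.mk u) = ((ord u : ℤ) : ZMod p) := fun u => rfl
  let g : IntertwiningMap (ρU.quotient _ (ModPRepCount.range_lsmul_le_comap ρU p))
      (Representation.trivial ℤ (E ≃ₐ[K] E) (ZMod p)) :=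
    gL.intertwiningMap_of_isIntertwiningMap _ _ fun σ x => by
      obtain ⟨u, rfl⟩ := Submodule.mkQ_surjective _ x
      rw [Representation.trivial_apply]
      change gL (Submodule.Quotient.mk (ρU σ u)) = gL (Submodule.Quotient.mk u)
      rw [hgL, hgL, hordσ]
  -- `f : 𝒪ˣ/p → Eˣ/p`
  have hfp : LinearMap.range (LinearMap.lsmul ℤ OU p) ≤
      (LinearMap.range (LinearMap.lsmul ℤ (Additive Eˣ) p)).comap OU.subtype := by
    rintro _ ⟨u, rfl⟩
    exact ⟨(u : Additive Eˣ), by simp [LinearMap.lsmul_apply]⟩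
  let fL := (LinearMap.range (LinearMap.lsmul ℤ OU p)).mapQ _ OU.subtype hfp
  have hfL : ∀ u : OU, fL (Submodule.Quotient.mk u) = Submodule.Quotient.mk (u : Additive Eˣ) := fun u => rfl
  let f : IntertwiningMap ((ρU.subrepresentation OU hOUst).quotient _
      (ModPRepCount.range_lsmul_le_comap (ρU.subrepresentation OU hOUst) p))
      (ρU.quotient _ (ModPRepCount.range_lsmul_le_comap ρU p)) :=
    fL.intertwiningMap_of_isIntertwiningMap _ _ fun σ x => by
      obtain ⟨u, rfl⟩ := Submodule.mkQ_surjective _ x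
      rfl
  -- injectivity of `f`
  have hf : Injective f := by
    change Injective fL
    rw [← LinearMap.ker_eq_bot, LinearMap.ker_eq_bot']
    intro x hx
    obtain ⟨u, rfl⟩ := Submodule.mkQ_surjective _ x
    rw [Submodule.mkQ_apply, hfL, Submodule.Quotient.mk_eq_zero] at hx
    obtain ⟨w, hw⟩ := hx
    rw [Submodule.mkQ_apply, Submodule.Quotient.mk_eq_zero]
    exact mem_range_lsmul_units p hp0 OU hOU u w (by simpa [LinearMap.lsmul_apply] using hw)
  -- surjectivity of `g`
  have hg : Surjective g := by
    change Surjective gL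
    intro c
    refine ⟨Submodule.Quotient.mk (-((c.val : ℤ) • Additive.ofMul ϖ)), ?_⟩
    rw [hgL, map_neg, map_zsmul, hordϖ]
    simp
  -- exactness
  have hfg' : LinearMap.range fL = LinearMap.ker gL := by
    apply le_antisymm
    · rintro _ ⟨x, rfl⟩
      obtain ⟨u, rfl⟩ := Submodule.mkQ_surjective _ x
      rw [LinearMap.mem_ker, Submodule.mkQ_apply, hfL, hgL, (hordO _).2 u.2, Int.cast_zero]
    · intro x hx
      obtain ⟨u, rfl⟩ := Submodule.mkQ_surjective _ x
      rw [LinearMap.mem_ker, Submodule.mkQ_apply, hgL, ZMod.intCast_zmod_eq_zero_iff_dvd] at hx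
      obtain ⟨k, hk⟩ := hx
      -- `u₀ := u + (p k) • ϖ` has `ord = 0`
      have hu₀ : u + ((p : ℤ) * k) • Additive.ofMul ϖ ∈ OU := by
        rw [← hordO, map_add, map_zsmul, hordϖ, hk, smul_eq_mul]; ring
      refine ⟨Submodule.Quotient.mk ⟨_, hu₀⟩, ?_⟩
      rw [hfL, Submodule.mkQ_apply, eq_comm, Submodule.Quotient.eq]
      refine ⟨-(k • Additive.ofMul ϖ), ?_⟩
      rw [LinearMap.lsmul_apply, smul_neg, smul_smul]
      change -(((p : ℤ) * k) • Additive.ofMul ϖ) = u - (u + ((p : ℤ) * k) • Additive.ofMul ϖ)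
      abel
  have hfg : LinearMap.range f.toLinearMap = LinearMap.ker g.toLinearMap := hfg'
  -- finiteness
  haveI : Finite (U₁ ⧸ LinearMap.range (LinearMap.lsmul ℤ U₁ p)) :=
    finite_quotient_one p hpv U₁ U₂ hU₁ hU₂ hU₁st O hO hOst (K := K)
  haveI : Finite (OU ⧸ U₁.comap OU.subtype) := finite_units_quotient_one p hpv OU U₁ hOU hU₁
  haveI hfinOU : Finite (OU ⧸ LinearMap.range (LinearMap.lsmul ℤ OU p)) :=
    finite_quotient_range_lsmul_of_finite p OU U₁ (one_le_units p hpv OU U₁ hOU hU₁)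
  haveI : Finite (Additive Eˣ ⧸ LinearMap.range (LinearMap.lsmul ℤ (Additive Eˣ) p)) := by
    haveI : Finite gL.toAddMonoidHom.range := Finite.of_injective _ Subtype.coe_injective
    haveI : Finite gL.toAddMonoidHom.ker := by
      have hk : ∀ x : gL.toAddMonoidHom.ker,
          (x : Additive Eˣ ⧸ LinearMap.range (LinearMap.lsmul ℤ (Additive Eˣ) p)) ∈ LinearMap.range fL :=
        fun x => by rw [hfg']; exact x.2
      haveI : Finite (LinearMap.range fL) := Finite.of_surjective _ (LinearMap.surjective_rangeRestrict fL)
      exact Finite.of_injective (fun x : gL.toAddMonoidHom.ker => (⟨x.1, hk x⟩ : LinearMap.range fL))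
        fun a b h => Subtype.ext (congrArg
          (fun t : LinearMap.range fL => (t : Additive Eˣ ⧸ LinearMap.range (LinearMap.lsmul ℤ (Additive Eˣ) p))) h)
    exact (AddMonoidHom.finite_iff_finite_ker_range gL.toAddMonoidHom).2 ⟨inferInstance, inferInstance⟩
  have hB : ∀ b : Additive Eˣ ⧸ LinearMap.range (LinearMap.lsmul ℤ (Additive Eˣ) p), p • b = 0 := by
    intro b
    obtain ⟨u, rfl⟩ := Submodule.mkQ_surjective _ b
    rw [← map_nsmul, Submodule.mkQ_apply, Submodule.Quotient.mk_eq_zero]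
    exact ⟨u, by rw [LinearMap.lsmul_apply, natCast_zsmul]⟩
  have key := ModPRepCount.natCard_intertwiningMap_eq_mul σZ
    ((ρU.subrepresentation OU hOUst).quotient _ (ModPRepCount.range_lsmul_le_comap (ρU.subrepresentation OU hOUst) p))
    (ρU.quotient _ (ModPRepCount.range_lsmul_le_comap ρU p))
    (Representation.trivial ℤ (E ≃ₐ[K] E) (ZMod p)) hG f g hf hg hfg hZ hB
  rw [ModPRepCount.natCard_intertwiningMap_zmod σZ hG hZ] at key
  exact key

end Count

end OneUnits

end Summit.BirchSwinnertonDyer.Rank1Residual.GaloisImage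

end
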